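import Summits.CriticalPhenomena.PercolationContinuityZ3.Theorems.PercNearOneGluingAdditiveGluingDConeAssembly
import Summits.CriticalPhenomena.PercolationContinuityZ3.Theorems.PercNearOneGluingAdditiveGluingSwitchClosure
import Summits.CriticalPhenomena.PercolationContinuityZ3.Theorems.PercNearOneGluingAdditiveGluingBlockPockets
import HarnessLib

/-! # Crux `PercNearOneGluing.AdditiveGluing` (stmt-CriticalPhenomena-4576) — block goodness IMPLIES the designated-pocket kernel
# (so every landed block-goodness closure is a closure of the weaker kernel of `additiveGluing_of_dcone`; seat (d) round 4)

Support file (`--supports stmt-CriticalPhenomena-4576`); no definitions, no named facts.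

`μ_u = prodBernoulli u`, relays `A ∋ b`, a block `S ≠ ∅` disjoint from `A`, a designation `d ∈ A`, `u/S` the glued weighting.
Block goodness (worst selection, un-glued form)
  `BG(u,S,d) :  μ_u(d↔b) + μ_u(d↮b, d↔S, S↔b) ≤ μ_u(S↔b) + Σ_{W∩A=∅} μ_u(K_S = W) · min_{a∈A} μ_u(a ↔ b in Wᶜ)`
implies the designated-pocket kernel (glued form, as consumed by `additiveGluing_of_dcone`)
  `D(u,S,d) :  μ_{u/S}((S ↔ A) ∩ (d ↔ b)) ≤ μ_{u/S}(S ↔ b)`.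
Proof (`dKernel_of_blockGood`): in `u/S`, `{d↔b}` contains the pairwise disjoint events `(S↔A) ∩ {d↔b}` and `{K_S = W} ∩ {d↔b}`,
`W ∩ A = ∅`; by the pocket Markov property (`stub_blockPocketMarkov_sp`) `μ'({K_S = W} ∩ {d↔b}) = μ'(K_S = W) · μ'(d ↔ b in Wᶜ)
≥ μ'(K_S = W) · min_a μ'(a ↔ b in Wᶜ)`; the glued quantities are the un-glued ones (`blockGrowth_glue_real_openConn/iUnion`,
`bk_pockets_glue`).  The difference `D − slack_BG` is the pocket deficit `Σ_W μ(K_S=W)[μ(d↔b off W) − min_a μ(a↔b off W)] ≥ 0`.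
[cite: KozmaNitzan2024, §3.2 Definition p. 12 ("a good graph satisfies the pre-FKG conjecture"), proof of Thm 5 p. 14]
-/

namespace Summit.CriticalPhenomena.PercolationContinuityZ3.Theorems

open MeasureTheory Set
open Literature.Probability.LatticeModels (prodBernoulli)
open Literature.Probability.Percolation (BondConfig openConn openConnIn openGraph openCluster)
open scoped BigOperators

noncomputable section
open Classical

section DKernelOfBlockGood

open Literature.Probability.LatticeModels Literature.Probability.Percolation

variable {n : ℕ}

/-- A dead kill-set excludes a block–relay connection: on `{K_S = W}` with `W ∩ A = ∅`, `S ↮ A`. [folklore] -/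
theorem dker_pocket_disjoint_reachA (S W A : Finset (Fin n)) (hWA : Disjoint W A) (ω : BondConfig (Fin n))
    (hW : ∀ z : Fin n, (z ∈ W ↔ ω ∈ ⋃ v ∈ S, openConn v z)) :
    ω ∉ (⋃ v ∈ S, ⋃ a ∈ A, (openConn v a : Set (BondConfig (Fin n)))) := by
  intro h
  simp only [Set.mem_iUnion] at h
  obtain ⟨v, hv, a, ha, hva⟩ := h
  have haW : a ∈ W := (hW a).2 (Set.mem_iUnion₂.2 ⟨v, hv, hva⟩)
  exact Finset.disjoint_left.1 hWA haW ha

/-- **Block goodness implies the designated-pocket kernel** (glued form).  [cite: KozmaNitzan2024, §3.2 Definition p. 12, p. 14] -/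
theorem dKernel_of_blockGood (u : Sym2 (Fin n) → unitInterval) (A S : Finset (Fin n)) (b d : Fin n) (hb : b ∈ A)
    (hS : S.Nonempty) (hd : d ∈ A)
    (hBG : (prodBernoulli u).real (openConn d b)
          + (prodBernoulli u).real
              ((openConn d b)ᶜ ∩ (⋃ v ∈ S, openConn d v) ∩ (⋃ v ∈ S, openConn v b))
        ≤ (prodBernoulli u).real (⋃ v ∈ S, openConn v b)
          + (∑ W ∈ (Finset.univ : Finset (Finset (Fin n))).filter (fun W => Disjoint W A),
              (prodBernoulli u).real
                  {ω : BondConfig (Fin n) | ∀ z : Fin n, (z ∈ W ↔ ω ∈ ⋃ v ∈ S, openConn v z)}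
                * A.inf' ⟨b, hb⟩ (fun a => (prodBernoulli u).real (openConnIn ((W : Set (Fin n))ᶜ) a b)))) :
    (prodBernoulli (fun e : Sym2 (Fin n) => if (∀ y ∈ e, y ∈ S) ∧ ¬ e.IsDiag then 1 else u e)).real
        ((⋃ v ∈ S, ⋃ a ∈ A, openConn v a) ∩ openConn d b)
      ≤ (prodBernoulli (fun e : Sym2 (Fin n) => if (∀ y ∈ e, y ∈ S) ∧ ¬ e.IsDiag then 1 else u e)).real
        (⋃ v ∈ S, openConn v b) := by
  set g : Sym2 (Fin n) → unitInterval := fun e : Sym2 (Fin n) => if (∀ y ∈ e, y ∈ S) ∧ ¬ e.IsDiag then 1 else u e with hg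
  -- block goodness in glued form
  have hBG' : (prodBernoulli g).real (openConn d b)
      ≤ (prodBernoulli g).real (⋃ v ∈ S, openConn v b)
        + ∑ W ∈ (Finset.univ : Finset (Finset (Fin n))).filter (fun W => Disjoint W A),
            (prodBernoulli g).real {ω : BondConfig (Fin n) | ∀ z : Fin n, (z ∈ W ↔ ω ∈ ⋃ v ∈ S, openConn v z)}
              * A.inf' ⟨b, hb⟩ (fun a => (prodBernoulli g).real (openConnIn ((W : Set (Fin n))ᶜ) a b)) := by
    rw [hg, blockGrowth_glue_real_openConn u S d b, blockGrowth_glue_real_iUnion u S b, bk_pockets_glue u A S b hb]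
    exact hBG
  -- the dead-pocket pieces of `{d ↔ b}` in the glued weighting
  set F : Finset (Fin n) → Set (BondConfig (Fin n)) :=
    fun W => {ω : BondConfig (Fin n) | ∀ z : Fin n, (z ∈ W ↔ ω ∈ ⋃ v ∈ S, openConn v z)} ∩ openConn d b with hF
  have hdisj : Set.PairwiseDisjoint
      (↑((Finset.univ : Finset (Finset (Fin n))).filter (fun W => Disjoint W A)) : Set (Finset (Fin n))) F := by
    intro W₁ _ W₂ _ hne
    rw [Function.onFun, Set.disjoint_left]
    rintro ω ⟨h1, -⟩ ⟨h2, -⟩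
    apply hne
    ext z
    exact (h1 z).trans (h2 z).symm
  have hU : (⋃ W ∈ (Finset.univ : Finset (Finset (Fin n))).filter (fun W => Disjoint W A), F W)
      ⊆ openConn d b \ ((⋃ v ∈ S, ⋃ a ∈ A, openConn v a) ∩ openConn d b) := by
    intro ω hω
    simp only [Set.mem_iUnion] at hω
    obtain ⟨W, hW, hωW⟩ := hω
    have hWA : Disjoint W A := (Finset.mem_filter.1 hW).2
    refine ⟨hωW.2, fun h => ?_⟩
    exact dker_pocket_disjoint_reachA S W A hWA ω hωW.1 h.1
  have hsum : (∑ W ∈ (Finset.univ : Finset (Finset (Fin n))).filter (fun W => Disjoint W A), (prodBernoulli g).real (F W))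
      ≤ (prodBernoulli g).real (openConn d b) - (prodBernoulli g).real ((⋃ v ∈ S, ⋃ a ∈ A, openConn v a) ∩ openConn d b) := by
    rw [← measureReal_biUnion_finset hdisj (fun W _ => MeasurableSet.of_discrete),
      ← measureReal_sdiff (μ := prodBernoulli g) Set.inter_subset_right MeasurableSet.of_discrete]
    exact measureReal_mono hU (measure_ne_top _ _)
  -- each dead-pocket piece dominates the worst-selection pocket term (pocket Markov property)
  have hterm : ∀ W ∈ (Finset.univ : Finset (Finset (Fin n))).filter (fun W => Disjoint W A),
      (prodBernoulli g).real {ω : BondConfig (Fin n) | ∀ z : Fin n, (z ∈ W ↔ ω ∈ ⋃ v ∈ S, openConn v z)}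
          * A.inf' ⟨b, hb⟩ (fun a => (prodBernoulli g).real (openConnIn ((W : Set (Fin n))ᶜ) a b))
        ≤ (prodBernoulli g).real (F W) := by
    intro W hW
    have hWA : Disjoint W A := (Finset.mem_filter.1 hW).2
    have hdW : d ∉ W := fun h => Finset.disjoint_left.1 hWA h hd
    have hmk := stub_blockPocketMarkov_sp n g S W hS d b hdW
    rw [hF]
    show _ ≤ (prodBernoulli g).real ({ω : BondConfig (Fin n) | ∀ z : Fin n, (z ∈ W ↔ ω ∈ ⋃ v ∈ S, openConn v z)} ∩ openConn d b)
    rw [← hmk]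
    exact mul_le_mul_of_nonneg_left (Finset.inf'_le _ hd) measureReal_nonneg
  have hsum' := Finset.sum_le_sum hterm
  linarith

end DKernelOfBlockGood

end

end Summit.CriticalPhenomena.PercolationContinuityZ3.Theorems
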